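import Summits.ResolutionOfSingularities.ResolutionOfSingularities.Theorems.MarkedTransferCampaignW21OrderBoundInClass
import HarnessLib

/-!
# [OURS · L1 W2.1] Reductions: the quantitative Lucas bound implies the order bound on the Lucas class

Rung L of cell res-hironaka, RESCUE-SEED row L-G2, slot W2.1; kill test K2.1 (seat res-L1-k21). The OURS campaign file
`MarkedTransferCampaignW21OrderBoundInClass.lean` (res-L1-type-o3) names `LucasBound p` (the quantitative Case-(I)
bound «∃ j, q|γ_j| + (ord ε ∸ q|γ₀|) ≤ ord H♭ε», SIZED-ASK-L §S-s21 FIRST LEMMA) and the class bounds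
`OrderBoundLongGammas p`, `OrderBoundInClass p` (on `LucasClass = LongGammas ∨ ShortTopGamma`). Its docstring says
«each of `OrderBoundLongGammas`, `OrderBoundMinDegreeTop`, `OrderBoundInClass` follows from [`LucasBound`] by
arithmetic». THIS FILE PROVES the two arithmetic reductions `LucasBound p → OrderBoundLongGammas p` and
`LucasBound p → OrderBoundInClass p` (pure `ℕ∞` bookkeeping, no analysis of `H♭`), so that the campaign's remaining
analytic target for the slot theorem `OrderBoundInClass p` is exactly `LucasBound p`. (`OrderBoundMinDegreeTop p` is
proved outright in `MarkedTransferCampaignW21MinDegreeTop.lean`, p463892.) OURS / folklore; nothing here is a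
statement of or about the manuscript under adjudication; AI-produced formalisation.
-/

noncomputable section

set_option linter.dupNamespace false -- mandated namespace of this single-conjunct summit

namespace Summit.ResolutionOfSingularities.ResolutionOfSingularities.Theorems

namespace CampaignW21

open Literature.AlgebraicGeometry.Hironaka2017.S09LLUED
open Literature.AlgebraicGeometry.Hironaka2017.S09LLUED.TopFrontier
open Literature.AlgebraicGeometry.Resolution

/-- `ℕ∞` bookkeeping behind the «SHORT TOP GAMMA» slice: if `G₀ ≤ O`, `G₀ ≤ Gj` and `Gj + (O - G₀) ≤ H` then `O ≤ H`.
[folklore] -/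
theorem enat_le_of_short {O H : ℕ∞} {G₀ Gj : ℕ} (h0 : (G₀ : ℕ∞) ≤ O) (hj : G₀ ≤ Gj)
    (hH : (Gj : ℕ∞) + (O - (G₀ : ℕ∞)) ≤ H) : O ≤ H := by
  induction O using ENat.recTopCoe with
  | top =>
    -- `⊤ - ↑G₀ = ⊤`, so `H = ⊤`
    rw [ENat.top_sub_coe, add_top] at hH
    exact hH
  | coe o =>
    have h0' : G₀ ≤ o := by exact_mod_cast h0
    have : ((Gj : ℕ∞) + ((o : ℕ∞) - (G₀ : ℕ∞))) = ((Gj + (o - G₀) : ℕ) : ℕ∞) := by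
      rw [← ENat.coe_sub, ← Nat.cast_add]
    rw [this] at hH
    have hle : (o : ℕ∞) ≤ ((Gj + (o - G₀) : ℕ) : ℕ∞) := by exact_mod_cast (by omega : o ≤ Gj + (o - G₀))
    exact hle.trans hH

/-- **[OURS · L1 W2.1] `LucasBound p → OrderBoundLongGammas p`**: on the class «every top-block exponent has
`q|γ_j| ≥ ord ε`» the quantitative bound gives `ord ε ≤ q|γ_j| ≤ q|γ_j| + (ord ε ∸ q|γ₀|) ≤ ord H♭ε`. Pure
arithmetic; NOT a statement of the manuscript. [folklore] -/
theorem orderBoundLongGammas_of_lucasBound (p : ℕ) [Fact p.Prime] (hL : LucasBound p) :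
    OrderBoundLongGammas p := by
  intro K _ _ n e ℓ ε S h0 hS _hI hC
  obtain ⟨j, hj⟩ := hL K n e ℓ ε S h0 hS
  exact (hC j).trans (le_self_add.trans hj)

/-- **[OURS · L1 W2.1] `LucasBound p → OrderBoundInClass p`**: on `LucasClass = LongGammas ∨ ShortTopGamma` the
quantitative bound gives `ord ε ≤ ord H♭ε` — for `LongGammas` as above; for `ShortTopGamma` (`q|γ₀| ≤ ord ε`, `γ₀`
of minimal length) from `q|γ_j| + (ord ε − q|γ₀|) ≥ q|γ₀| + (ord ε − q|γ₀|) = ord ε`. Hence the slot theorem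
`OrderBoundInClass p` is reduced to the single analytic lemma `LucasBound p`. Pure arithmetic; NOT a statement of
the manuscript. [folklore] -/
theorem orderBoundInClass_of_lucasBound (p : ℕ) [Fact p.Prime] (hL : LucasBound p) :
    OrderBoundInClass p := by
  intro K _ _ n e ℓ ε S h0 hS _hI hC
  obtain ⟨j, hj⟩ := hL K n e ℓ ε S h0 hS
  rcases hC with hLong | hShort
  · exact (hLong j).trans (le_self_add.trans hj)
  · obtain ⟨hq0, hmin⟩ := hShort h0
    refine enat_le_of_short hq0 ?_ hj
    exact Nat.mul_le_mul_left _ (hmin j)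

end CampaignW21

end Summit.ResolutionOfSingularities.ResolutionOfSingularities.Theorems

end
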